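import Summits.QuantumAdvantage.AdviceFreeQNC0.HiddenCoinsReduction
import Summits.QuantumAdvantage.AdviceFreeQNC0.LinFormsRegular
import HarnessLib

/-!
# OddPrimeWalk — the COLUMN-RESOLUTION RUNG at `p = 5`, core: cells, fibres and the Fourier expansion
# (item stmt-QuantumAdvantage-24278 `ColumnResolutionRungFive`; planner qa-qnc0-p2 g32, PROOF-MC §4/§9; prover qn-prover-3 g20)

A strategy `y` reading the input `u` only through the pinned bits `u|_S` and the counters mod 5 of the free classes of a colouring
`κ` plays, on every cell `{u : u|_S = π, counts = v}`, a FIXED oblivious firing set `Y_{π,v}` (`Yset`, `y_eq_Yset`).  The win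
count on a fibre `{u|_S = π}` is expanded over the characters of `(ℤ/5)^K` (qn-lit's `TwoModuli.sum_cell_eq_sum_twisted` with the
class-indicator forms `lam`): `card_fibre_win_eq`.  The trivial character gives the plain count of `Y_{π,v}` on the fibre, bounded by
any free-phase bound `FreePhase.Bound (n − |S|) k` through the tree's `HiddenCoins.card_win_ext_le` (`card_fibre_winY_le`); a
non-trivial character `γ` is a fibre twisted sum with phase vector `β(γ)_i = γ_{κ i}·[i ∉ S]` (`beta_eq`), whose support off `S`
has `≥ L·#supp γ` elements when every free class has `≥ L` members (`mul_card_supp_le`).  The per-fibre estimate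
`card_fibre_win_le` takes the fibre twist bound (item 24323) as a HYPOTHESIS `hTB`, so that this file only imports landed modules;
`OddPrimeWalkColumnResolutionRung` supplies `oddPrimeWalk_fibreTwistBoundFive`, the floor, the error numerics and the closer.
WHAT THIS IS NOT: no bound yet — the assembly is in `OddPrimeWalkColumnResolutionRung`.
-/

noncomputable section

namespace Summit.QuantumAdvantage.AdviceFreeQNC0

open Finset Literature.Computability.MetaComplexity

namespace ColRes

open HiddenCoins Subcube

variable {n K : ℕ} (S : Finset (Fin n)) (κ : Fin n → Fin K)

/-! ### Counters, indicator forms, phase vectors -/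

/-- The free-class counter mod 5 (literal form of the item). -/
def cntZ (u : Fin n → Bool) (k : Fin K) : ZMod 5 :=
  ((univ.filter fun i : Fin n => i ∉ S ∧ κ i = k ∧ u i = true).card : ℕ)

/-- The indicator linear form of the free class `k`. -/
def lam (k : Fin K) (i : Fin n) : ZMod 5 := if i ∉ S ∧ κ i = k then 1 else 0

/-- The residue vector of the indicator forms is the counter vector. -/
theorem resVec_lam (u : Fin n → Bool) : (fun k => ∑ i, if u i then lam S κ k i else 0) = cntZ S κ u := by
  funext k
  unfold lam cntZ
  rw [Finset.natCast_card_filter]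
  refine sum_congr rfl fun i _ => ?_
  by_cases hu : u i = true <;> by_cases hp : (i ∉ S ∧ κ i = k) <;> simp [hu, hp]

/-- The combined phase vector of a dual vector `γ`: `β(γ)_i = γ_{κ i}` off `S`, `0` on `S`. -/
theorem beta_eq (γ : Fin K → ZMod 5) (i : Fin n) :
    (∑ j, γ j * lam S κ j i) = if i ∉ S then γ (κ i) else 0 := by
  unfold lam
  by_cases hi : i ∉ S
  · rw [if_pos hi]
    simp only [hi, not_false_eq_true, true_and, mul_ite, mul_one, mul_zero]
    rw [Finset.sum_ite_eq univ (κ i) (fun j => γ j)]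
    simp
  · rw [if_neg hi]
    simp [hi]

/-- The support of `β(γ)` off `S`. -/
theorem supp_beta_eq (γ : Fin K → ZMod 5) :
    ((univ \ S).filter fun i : Fin n => (∑ j, γ j * lam S κ j i) ≠ 0)
      = univ.filter fun i : Fin n => i ∉ S ∧ γ (κ i) ≠ 0 := by
  ext i
  simp only [mem_filter, mem_sdiff, mem_univ, true_and, beta_eq]
  constructor
  · rintro ⟨hi, h⟩
    rw [if_pos hi] at h
    exact ⟨hi, h⟩
  · rintro ⟨hi, h⟩
    rw [if_pos hi]
    exact ⟨hi, h⟩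

/-- **Large free classes make long phase vectors**: if every free class has `≥ L` members (and every class has a free member),
then `#supp(β(γ) off S) ≥ L · #supp γ`. -/
theorem mul_card_supp_le (L : ℕ) (hL : ∀ i : Fin n, i ∉ S → L ≤ (univ.filter fun i' : Fin n => i' ∉ S ∧ κ i' = κ i).card)
    (hne : ∀ k : Fin K, ∃ i : Fin n, i ∉ S ∧ κ i = k) (γ : Fin K → ZMod 5) :
    L * (univ.filter fun k : Fin K => γ k ≠ 0).card
      ≤ (univ.filter fun i : Fin n => i ∉ S ∧ γ (κ i) ≠ 0).card := by
  rw [card_eq_sum_card_fiberwise (f := κ) (s := univ.filter fun i : Fin n => i ∉ S ∧ γ (κ i) ≠ 0)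
    (t := univ.filter fun k : Fin K => γ k ≠ 0) (fun i hi => by
      rw [Finset.mem_coe, mem_filter] at hi ⊢; exact ⟨mem_univ _, hi.2.2⟩)]
  rw [mul_comm]
  have h : ∀ k ∈ (univ.filter fun k : Fin K => γ k ≠ 0),
      L ≤ ((univ.filter fun i : Fin n => i ∉ S ∧ γ (κ i) ≠ 0).filter fun i => κ i = k).card := by
    intro k hk
    rw [mem_filter] at hk
    obtain ⟨i₀, hi₀, hk₀⟩ := hne k
    refine (hL i₀ hi₀).trans (le_of_eq ?_)
    congr 1
    ext i
    simp only [mem_filter, mem_univ, true_and]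
    constructor
    · rintro ⟨hi, hκ⟩; rw [hκ, hk₀]; exact ⟨⟨hi, hk.2⟩, rfl⟩
    · rintro ⟨⟨hi, _⟩, hκ⟩; exact ⟨hi, by rw [hκ, hk₀]⟩
  calc (univ.filter fun k : Fin K => γ k ≠ 0).card * L
      = ∑ _k ∈ (univ.filter fun k : Fin K => γ k ≠ 0), L := by rw [sum_const, smul_eq_mul]
    _ ≤ _ := sum_le_sum h

/-! ### Cells: the strategy is oblivious on `{u|_S = π, counts = v}` -/

/-- Equal projections = agreement on `S`. -/
theorem proj_eq_iff (u u' : Fin n → Bool) : proj S u = proj S u' ↔ ∀ i ∈ S, u i = u' i := by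
  constructor
  · intro h i hi
    have := congrFun h i
    unfold proj at this
    rwa [if_pos hi, if_pos hi] at this
  · intro h
    funext i
    unfold proj
    by_cases hi : i ∈ S
    · rw [if_pos hi, if_pos hi, h i hi]
    · rw [if_neg hi, if_neg hi]

variable (y : Fin (n + 1) → (Fin n → Bool) → Bool)

/-- The fired set of the cell `(b, v)` (via a representative; `∅` for an empty cell). -/
def Yset (b : Fin n → Bool) (v : Fin K → ZMod 5) : Finset (Fin (n + 1)) :=
  if h : ∃ u : Fin n → Bool, proj S u = b ∧ cntZ S κ u = v then univ.filter (fun g => y g h.choose = true) else ∅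

/-- On its cell the strategy fires exactly `Yset`. -/
theorem y_eq_Yset
    (hy : ∀ g u u', (∀ i ∈ S, u i = u' i) → (∀ k, cntZ S κ u k = cntZ S κ u' k) → y g u = y g u')
    (u : Fin n → Bool) (b : Fin n → Bool) (v : Fin K → ZMod 5) (hb : proj S u = b) (hv : cntZ S κ u = v)
    (g : Fin (n + 1)) : y g u = decide (g ∈ Yset S κ y b v) := by
  have h : ∃ u : Fin n → Bool, proj S u = b ∧ cntZ S κ u = v := ⟨u, hb, hv⟩
  unfold Yset
  rw [dif_pos h]
  obtain ⟨hb₀, hv₀⟩ := h.choose_spec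
  have hyu : y g u = y g h.choose :=
    hy g u h.choose ((proj_eq_iff S u h.choose).mp (by rw [hb, hb₀])) (fun k => by rw [hv, hv₀])
  rw [hyu]
  simp

variable (c : ℕ)

/-- The weight of the cell `(b, v)`: the fibre indicator times the win indicator of the cell's oblivious strategy. -/
def Fw (b : Fin n → Bool) (v : Fin K → ZMod 5) (u : Fin n → Bool) : ℂ :=
  if proj S u = b then (if ringWinU c (fun g _ => decide (g ∈ Yset S κ y b v)) u = true then 1 else 0) else 0

/-- **The win count on a fibre, split over the cells.** -/
theorem card_fibre_win_eq
    (hy : ∀ g u u', (∀ i ∈ S, u i = u' i) → (∀ k, cntZ S κ u k = cntZ S κ u' k) → y g u = y g u')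
    (b : Fin n → Bool) :
    (((univ.filter fun u : Fin n → Bool => proj S u = b ∧ ringWinU c y u = true).card : ℕ) : ℂ) =
      ∑ v : Fin K → ZMod 5, ∑ u : Fin n → Bool,
        (if (fun k => ∑ i, if u i then lam S κ k i else 0) = v then Fw S κ y c b v u else 0) := by
  classical
  rw [Finset.natCast_card_filter, Finset.sum_comm]
  refine Finset.sum_congr rfl fun u _ => ?_
  simp_rw [resVec_lam]
  rw [Finset.sum_ite_eq, if_pos (mem_univ _)]
  unfold Fw
  by_cases hb : proj S u = b
  · rw [if_pos hb, LinForms.ringWinU_congr c (y' := fun g _ => decide (g ∈ Yset S κ y b (cntZ S κ u)))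
      (fun g => y_eq_Yset S κ y hy u b _ hb rfl g)]
    by_cases hw : ringWinU c (fun g _ => decide (g ∈ Yset S κ y b (cntZ S κ u))) u = true
    · rw [if_pos hw, if_pos ⟨hb, hw⟩]
    · rw [if_neg hw, if_neg (fun h => hw h.2)]
  · rw [if_neg hb, if_neg (fun h => hb h.1)]

/-! ### The two kinds of terms -/

/-- The trivial character's term is the count of the cell's oblivious strategy on the fibre. -/
theorem term_zero (b : Fin n → Bool) (v : Fin K → ZMod 5) :
    (∑ u : Fin n → Bool, (ZMod.stdAddChar (∑ i : Fin n, if u i then ∑ j, (0 : Fin K → ZMod 5) j * lam S κ j i else 0) : ℂ) *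
        Fw S κ y c b v u) =
      ((univ.filter fun u : Fin n → Bool =>
          proj S u = b ∧ ringWinU c (fun g _ => decide (g ∈ Yset S κ y b v)) u = true).card : ℂ) := by
  rw [Finset.natCast_card_filter]
  refine Finset.sum_congr rfl fun u _ => ?_
  have h0 : (∑ i : Fin n, if u i then ∑ j, (0 : Fin K → ZMod 5) j * lam S κ j i else 0) = 0 :=
    Finset.sum_eq_zero fun i _ => by simp
  rw [h0, AddChar.map_zero_eq_one, one_mul]
  unfold Fw
  by_cases hb : proj S u = b
  · rw [if_pos hb]
    by_cases hw : ringWinU c (fun g _ => decide (g ∈ Yset S κ y b v)) u = true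
    · rw [if_pos hw, if_pos ⟨hb, hw⟩]
    · rw [if_neg hw, if_neg (fun h => hw h.2)]
  · rw [if_neg hb, if_neg (fun h => hb h.1)]

/-- **The oblivious count on a fibre is bounded by the free-phase game** (tree: `HiddenCoins.card_win_ext_le`). -/
theorem card_fibre_winY_le {k : ℕ} (hB : FreePhase.Bound (n - S.card) k) (Y : Finset (Fin (n + 1))) (u₁ : Fin n → Bool) :
    (univ.filter fun u : Fin n → Bool =>
        proj S u = proj S u₁ ∧ ringWinU c (fun g _ => decide (g ∈ Y)) u = true).card ≤ k := by
  classical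
  refine le_trans ?_ (card_win_ext_le S (proj S u₁) c (fun g _ => decide (g ∈ Y)) hB (fun _ _ _ _ => rfl))
  refine card_le_card_of_injOn (res S) ?_ ?_
  · intro u hu
    rw [mem_coe, mem_filter] at hu
    rw [mem_coe, mem_filter]
    refine ⟨mem_univ _, ?_⟩
    rw [← hu.2.1, ext_proj_res]
    exact hu.2.2
  · intro u hu u' hu' heq
    rw [mem_coe, mem_filter] at hu hu'
    rw [← ext_proj_res S u, ← ext_proj_res S u', hu.2.1, hu'.2.1, heq]

/-- A non-trivial term is a fibre twisted sum (to be bounded by `FibreTwistBoundFive`). -/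
theorem term_eq_fibre_sum (γ : Fin K → ZMod 5) (b : Fin n → Bool) (v : Fin K → ZMod 5) (u₁ : Fin n → Bool)
    (hb : proj S u₁ = b) :
    (∑ u : Fin n → Bool, (ZMod.stdAddChar (∑ i : Fin n, if u i then ∑ j, γ j * lam S κ j i else 0) : ℂ) *
        Fw S κ y c b v u) =
      ∑ u ∈ (univ.filter fun u : Fin n → Bool => ∀ i ∈ S, u i = b i),
        (if ringWinU c (fun g _ => decide (g ∈ Yset S κ y b v)) u = true then (1 : ℂ) else 0) *
          Complex.exp (2 * Real.pi * Complex.I *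
            (((∑ i, if u i then (fun i => ∑ j, γ j * lam S κ j i) i else 0).val : ℝ) : ℂ) / (5 : ℂ)) := by
  rw [Finset.sum_filter]
  refine Finset.sum_congr rfl fun u _ => ?_
  have hfib : (∀ i ∈ S, u i = b i) ↔ proj S u = b := by
    rw [← hb, proj_eq_iff]
    constructor
    · intro h i hi; rw [h i hi]; unfold proj; rw [if_pos hi]
    · intro h i hi; rw [h i hi]; unfold proj; rw [if_pos hi]
  unfold Fw
  by_cases hp : proj S u = b
  · rw [if_pos hp, if_pos (hfib.mpr hp)]
    rw [show ((5 : ℂ)) = ((5 : ℕ) : ℂ) from by norm_num,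
      Literature.Computability.MetaComplexity.TwoModuli.exp_val_eq_stdAddChar]
    ring
  · rw [if_neg hp, if_neg (fun h => hp (hfib.mp h)), mul_zero]

/-! ### The per-fibre estimate -/

/-- The statement of the fibre twist bound at `p = 5` (item 24323), as consumed here. -/
def FibreTB (n : ℕ) : Prop :=
  ∀ (c : ℕ) (S : Finset (Fin n)) (π : Fin n → Bool) (Y : Finset (Fin (n + 1))) (β : Fin n → ZMod 5),
    ‖∑ u ∈ (Finset.univ.filter fun u : Fin n → Bool => ∀ i ∈ S, u i = π i),
        (if ringWinU c (fun g _ => decide (g ∈ Y)) u = true then (1 : ℂ) else 0) *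
          Complex.exp (2 * Real.pi * Complex.I * (((∑ i, if u i then β i else 0).val : ℝ) : ℂ) / (5 : ℂ))‖
      ≤ 3 * Real.sqrt 6 * Real.cos (Real.pi / 15) ^ ((Finset.univ \ S).filter fun i => β i ≠ 0).card
          * (2 : ℝ) ^ (n - S.card)

/-- The error sum of the expansion: `Σ_γ ρ^{L·#supp γ} = (1 + 4ρ^L)^K`. -/
theorem sum_pow_supp (ρ : ℝ) (L : ℕ) :
    ∑ γ : Fin K → ZMod 5, ρ ^ (L * (univ.filter fun k : Fin K => γ k ≠ 0).card) = (1 + 4 * ρ ^ L) ^ K := by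
  classical
  have hprod : ∀ γ : Fin K → ZMod 5, ρ ^ (L * (univ.filter fun k : Fin K => γ k ≠ 0).card) =
      ∏ k : Fin K, (if γ k ≠ 0 then ρ ^ L else 1) := by
    intro γ
    rw [Finset.prod_ite, Finset.prod_const, Finset.prod_const_one, mul_one, ← pow_mul]
  simp_rw [hprod]
  have hsum : ∀ _k : Fin K, (∑ a : ZMod 5, (if a ≠ 0 then ρ ^ L else (1 : ℝ))) = 1 + 4 * ρ ^ L := by
    intro _
    have e : ∀ a : ZMod 5, (if a ≠ 0 then ρ ^ L else (1 : ℝ)) = ρ ^ L + (if a = 0 then 1 - ρ ^ L else 0) := by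
      intro a; by_cases ha : a = 0 <;> simp [ha]
    simp_rw [e]
    rw [sum_add_distrib, sum_const, sum_ite_eq' univ (0 : ZMod 5), if_pos (mem_univ _), card_univ, ZMod.card]
    simp only [nsmul_eq_mul]
    push_cast
    ring
  have hK : (1 + 4 * ρ ^ L) ^ K = ∏ _k : Fin K, (1 + 4 * ρ ^ L) := by
    rw [Finset.prod_const, card_univ, Fintype.card_fin]
  rw [hK, show (∏ _k : Fin K, (1 + 4 * ρ ^ L)) = ∏ k : Fin K, ∑ a : ZMod 5, (if a ≠ 0 then ρ ^ L else (1 : ℝ)) from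
    prod_congr rfl fun k _ => (hsum k).symm, Finset.prod_univ_sum]
  simp [Fintype.piFinset_univ]

/-- **Per-fibre estimate.**  With every free class of size `≥ L` (and represented), a free-phase bound `k` on `n − |S|` coins
and the fibre twist bound, the strategy wins on at most `k + 3√6·((1 + 4ρ^L)^K − 1)·2^{n−|S|}` inputs of each fibre,
`ρ = cos(π/15)`. -/
theorem card_fibre_win_le (hTB : FibreTB n)
    (hy : ∀ g u u', (∀ i ∈ S, u i = u' i) → (∀ k, cntZ S κ u k = cntZ S κ u' k) → y g u = y g u')
    (L : ℕ) (hL : ∀ i : Fin n, i ∉ S → L ≤ (univ.filter fun i' : Fin n => i' ∉ S ∧ κ i' = κ i).card)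
    (hne : ∀ k : Fin K, ∃ i : Fin n, i ∉ S ∧ κ i = k) {k : ℕ} (hB : FreePhase.Bound (n - S.card) k)
    (u₁ : Fin n → Bool) :
    ((univ.filter fun u : Fin n → Bool => proj S u = proj S u₁ ∧ ringWinU c y u = true).card : ℝ) ≤
      k + 3 * Real.sqrt 6 * ((1 + 4 * Real.cos (Real.pi / 15) ^ L) ^ K - 1) * (2 : ℝ) ^ (n - S.card) := by
  classical
  set b := proj S u₁ with hbdef
  set ρ : ℝ := Real.cos (Real.pi / 15) with hρ
  have hρ0 : 0 ≤ ρ :=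
    Real.cos_nonneg_of_neg_pi_div_two_le_of_le (by linarith [Real.pi_pos]) (by linarith [Real.pi_pos])
  have hρ1 : ρ ≤ 1 := Real.cos_le_one _
  set M : ℝ := (2 : ℝ) ^ (n - S.card) with hM
  -- the term bounds
  have hterm : ∀ (v γ : Fin K → ZMod 5), ‖(ZMod.stdAddChar (-∑ j, γ j * v j) : ℂ) *
      ∑ u : Fin n → Bool, (ZMod.stdAddChar (∑ i : Fin n, if u i then ∑ j, γ j * lam S κ j i else 0) : ℂ) *
        Fw S κ y c b v u‖ ≤
      (if γ = 0 then (k : ℝ) else 3 * Real.sqrt 6 * ρ ^ (L * (univ.filter fun k : Fin K => γ k ≠ 0).card) * M) := by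
    intro v γ
    rw [norm_mul, show ‖(ZMod.stdAddChar (-∑ j, γ j * v j) : ℂ)‖ = 1 from AddChar.norm_apply _ _, one_mul]
    by_cases hγ : γ = 0
    · rw [if_pos hγ, hγ, term_zero, Complex.norm_natCast]
      exact_mod_cast card_fibre_winY_le S c hB (Yset S κ y b v) u₁
    · rw [if_neg hγ, term_eq_fibre_sum S κ y c γ b v u₁ rfl]
      refine (hTB c S b (Yset S κ y b v) (fun i => ∑ j, γ j * lam S κ j i)).trans ?_
      rw [supp_beta_eq]
      have hsupp := mul_card_supp_le S κ L hL hne γ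
      have hpow : ρ ^ (univ.filter fun i : Fin n => i ∉ S ∧ γ (κ i) ≠ 0).card ≤
          ρ ^ (L * (univ.filter fun k : Fin K => γ k ≠ 0).card) := pow_le_pow_of_le_one hρ0 hρ1 hsupp
      have h6 : 0 ≤ 3 * Real.sqrt 6 := by positivity
      have hM0 : 0 ≤ M := by positivity
      exact mul_le_mul_of_nonneg_right (mul_le_mul_of_nonneg_left hpow h6) hM0
  -- the cells
  set E : ℝ := (1 + 4 * ρ ^ L) ^ K - 1 with hE
  have hsumγ : ∑ γ : Fin K → ZMod 5,
      (if γ = 0 then (k : ℝ) else 3 * Real.sqrt 6 * ρ ^ (L * (univ.filter fun k : Fin K => γ k ≠ 0).card) * M)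
        = k + 3 * Real.sqrt 6 * E * M := by
    rw [← Finset.add_sum_erase _ _ (mem_univ (0 : Fin K → ZMod 5)), if_pos rfl]
    congr 1
    have h1 : ∑ γ ∈ (univ : Finset (Fin K → ZMod 5)).erase 0,
        (if γ = 0 then (k : ℝ) else 3 * Real.sqrt 6 * ρ ^ (L * (univ.filter fun k : Fin K => γ k ≠ 0).card) * M)
        = ∑ γ ∈ (univ : Finset (Fin K → ZMod 5)).erase 0,
          3 * Real.sqrt 6 * M * ρ ^ (L * (univ.filter fun k : Fin K => γ k ≠ 0).card) :=
      Finset.sum_congr rfl fun γ hγ => by rw [if_neg (Finset.ne_of_mem_erase hγ)]; ring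
    rw [h1, ← Finset.mul_sum]
    have h2 : ∑ γ ∈ (univ : Finset (Fin K → ZMod 5)).erase 0, ρ ^ (L * (univ.filter fun k : Fin K => γ k ≠ 0).card)
        = E := by
      rw [hE, ← sum_pow_supp ρ L, ← Finset.add_sum_erase _ _ (mem_univ (0 : Fin K → ZMod 5))]
      simp
    rw [h2]; ring
  have hcell : ∀ v : Fin K → ZMod 5, ‖∑ u : Fin n → Bool,
      (if (fun k => ∑ i, if u i then lam S κ k i else 0) = v then Fw S κ y c b v u else 0)‖ ≤
      ((5 : ℝ) ^ K)⁻¹ * (k + 3 * Real.sqrt 6 * E * M) := by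
    intro v
    haveI : Fact (Nat.Prime 5) := ⟨by norm_num⟩
    rw [Literature.Computability.MetaComplexity.TwoModuli.sum_cell_eq_sum_twisted (lam S κ) v (Fw S κ y c b v),
      norm_mul, norm_inv, norm_pow]
    rw [show ‖((5 : ℕ) : ℂ)‖ = (5 : ℝ) from by simp]
    refine mul_le_mul_of_nonneg_left ?_ (by positivity)
    refine (norm_sum_le _ _).trans ?_
    rw [← hsumγ]
    exact Finset.sum_le_sum fun γ _ => hterm v γ
  -- sum over the cells
  have hmain : ‖(((univ.filter fun u : Fin n → Bool => proj S u = b ∧ ringWinU c y u = true).card : ℕ) : ℂ)‖ ≤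
      (5 : ℝ) ^ K * (((5 : ℝ) ^ K)⁻¹ * (k + 3 * Real.sqrt 6 * E * M)) := by
    rw [card_fibre_win_eq S κ y c hy b]
    refine (norm_sum_le _ _).trans ?_
    calc (∑ v : Fin K → ZMod 5, ‖∑ u : Fin n → Bool,
          (if (fun k => ∑ i, if u i then lam S κ k i else 0) = v then Fw S κ y c b v u else 0)‖)
        ≤ ∑ _v : Fin K → ZMod 5, ((5 : ℝ) ^ K)⁻¹ * (k + 3 * Real.sqrt 6 * E * M) :=
          Finset.sum_le_sum fun v _ => hcell v
      _ = (5 : ℝ) ^ K * (((5 : ℝ) ^ K)⁻¹ * (k + 3 * Real.sqrt 6 * E * M)) := by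
          rw [Finset.sum_const, nsmul_eq_mul, Finset.card_univ, Fintype.card_fun, ZMod.card, Fintype.card_fin]
          push_cast; ring
  rw [Complex.norm_natCast] at hmain
  have h5K : (5 : ℝ) ^ K ≠ 0 := pow_ne_zero _ (by norm_num)
  rw [← mul_assoc, mul_inv_cancel₀ h5K, one_mul] at hmain
  rw [hE, hM] at hmain
  linarith

end ColRes

end Summit.QuantumAdvantage.AdviceFreeQNC0

end
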